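import Mathlib.GroupTheory.Perm.Cycle.Type
import Mathlib.GroupTheory.Perm.Centralizer
import HarnessLib

/-!
# Full cycles: Jerrum–Snir's induced cyclic permutation `π*` and vertex insertion
(J. ACM 29 (1982), §4.4, p. 890)

Combinatorics of the permutations `π` of a finite type `α` consisting of one cycle through all of
`α` (`π.cycleType = {card α}`; these index the monomials of the Hamiltonian circuit polynomial
`hcPoly`, `StandardFamilies.lean`), used by the discharge of the named fact
`JerrumSnir1982_hamiltonianCircuit` (`MonotoneGapHamiltonian.lean`) in the sibling files
`MonotoneGapHamiltonianLower.lean` (content bound) and `MonotoneGapHamiltonianUpper.lean`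
(dynamic programme):

* [JerrumSnir1982] M. Jerrum, M. Snir, *Some exact complexity results for straight-line
  computations over semirings*, J. ACM 29 (1982) 874–897, §4.4 (p. 890): "Suppose we fix `m_b`,
  `m_c`, that is, fix `π` on `I_b ∪ I_c`; we wish to know the number of possible choices for `m_a`,
  that is, the number of ways of extending `π` to `I_a`. Define `π* : I_a → I_a`, `π*(i) = π^a(i)`,
  where `a` is the smallest positive number such that `π^a(i) ∈ I_a` (such an `a` exists since `π`
  is cyclic). Informally, viewing `π` as a circle, `π*` is the circle obtained by deleting vertices
  not in `I_a`. Note that `π` is completely determined by `π*` and the restriction of `π` to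
  `I_b ∪ I_c`. We observe that `π*` is a cyclic permutation; hence the number of extensions of `π`
  to `I_a` is bounded by the number of cyclic permutations on `d` objects; that is,
  `|mon(a)| ≤ (d - 1)!`."

Contents (all for a full cycle `π` and a nonempty `S : Finset α`, JS's `I_a`):

* `cycleType_eq_card_iff` — full cycle `↔ IsCycle ∧ support = univ`; orbits reach everything.
* `firstIn π S y` — the first point of `S` on the forward orbit of `y`; `ret π S x = firstIn π S (π x)`
  is JS's `π*` (first return to `S`); `firstIn_eq_of_agree` — it depends only on `π` off `S`;
  `firstIn_apply_injOn` — `π x ↦ π*(x)` is injective on `x ∈ S` (the deleted arcs `π|_{Sᶜ}` form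
  disjoint chains); `eq_of_ret_eq` — **`π` is determined by `π*` and `π|_{Sᶜ}`**.
* `retPerm` — `π*` as a permutation of `↥S`; `retPerm_cycleType` — **`π*` is a cyclic permutation**
  of `S` (no fixed point: a first return to `x` before meeting the rest of `S` would close the
  `n`-cycle early; one orbit: the visits of the `π`-orbit of `x` to `S` are the `π*`-orbit of `x`).
* `card_le_factorial_of_agree` — **the extension count**: a set of full cycles that pairwise agree
  off `S` has at most `(|S| - 1)!` elements (injection `π ↦ π*` into the cyclic permutations of `S`,
  counted by Mathlib's `Equiv.Perm.card_of_cycleType_singleton`; `|S| = 1` directly).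
* `isCycle_swap_mul_of_apply_eq_self` — inserting a fixed point `j` of a cycle `π'` after
  `π'⁻¹ y` (`swap j y * π'`) gives a cycle with support `insert j (support π')` (the converse of
  Mathlib's `Equiv.Perm.IsCycle.swap_mul` / `support_swap_mul_eq`); this is the splicing step of the
  Hamiltonian-path dynamic programme of JS p. 890–891 (`MonotoneGapHamiltonianUpper.lean`).
-/

noncomputable section

namespace Literature.Barriers.ValiantsHypothesis

namespace JerrumSnir

open Equiv Equiv.Perm Finset

variable {α : Type*} [Fintype α] [DecidableEq α]

/-! ### Full cycles -/

section FullCycle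

variable {π : Perm α}

/-- A permutation has cycle type `{card α}` iff it is a cycle moving every point (a "cyclic
permutation of the first `n` natural numbers", JS's `C(n)`). [cite: JerrumSnir1982, §4.4 (p. 889)] -/
theorem cycleType_eq_card_iff :
    π.cycleType = {Fintype.card α} ↔ π.IsCycle ∧ π.support = Finset.univ := by
  constructor
  · intro h
    have hc : π.IsCycle := by
      rw [← card_cycleType_eq_one, h, Multiset.card_singleton]
    refine ⟨hc, ?_⟩
    have h1 := hc.cycleType
    rw [h, Multiset.singleton_inj] at h1
    exact (Finset.card_eq_iff_eq_univ _).1 h1.symm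
  · rintro ⟨hc, hs⟩
    rw [hc.cycleType, hs, Finset.card_univ]

/-- A full cycle moves every point. [folklore] -/
theorem apply_ne_self_of_cycleType (h : π.cycleType = {Fintype.card α}) (x : α) : π x ≠ x := by
  have hs := (cycleType_eq_card_iff.1 h).2
  have hx : x ∈ π.support := hs ▸ Finset.mem_univ x
  exact Perm.mem_support.1 hx

/-- The orbit of a full cycle is everything ("such an `a` exists since `π` is cyclic").
[cite: JerrumSnir1982, §4.4 (p. 890)] -/
theorem exists_pow_apply_eq_of_cycleType (h : π.cycleType = {Fintype.card α}) (x y : α) :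
    ∃ k : ℕ, (π ^ k) x = y :=
  (cycleType_eq_card_iff.1 h).1.exists_pow_eq (apply_ne_self_of_cycleType h x)
    (apply_ne_self_of_cycleType h y)

/-- A full cycle has no short return: `π^k x = x` with `0 < k` forces `card α ≤ k`. [folklore] -/
theorem card_le_of_pow_apply_eq_self (h : π.cycleType = {Fintype.card α}) {k : ℕ} (hk : 0 < k)
    {x : α} (hx : (π ^ k) x = x) : Fintype.card α ≤ k := by
  obtain ⟨hc, hs⟩ := cycleType_eq_card_iff.1 h
  have h1 : π ^ k = 1 := hc.pow_eq_one_iff.2 ⟨x, apply_ne_self_of_cycleType h x, hx⟩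
  have h2 : orderOf π ∣ k := orderOf_dvd_of_pow_eq_one h1
  rw [hc.orderOf, hs, Finset.card_univ] at h2
  exact Nat.le_of_dvd hk h2

/-- Every point is reached from every point in fewer than `card α` steps. [folklore] -/
theorem exists_pow_lt_apply_eq_of_cycleType (h : π.cycleType = {Fintype.card α}) (x y : α) :
    ∃ k < Fintype.card α, (π ^ k) x = y := by
  obtain ⟨k, hk⟩ := exists_pow_apply_eq_of_cycleType h x y
  obtain ⟨hc, hs⟩ := cycleType_eq_card_iff.1 h
  have ho : orderOf π = Fintype.card α := by rw [hc.orderOf, hs, Finset.card_univ]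
  refine ⟨k % Fintype.card α, Nat.mod_lt _ (Fintype.card_pos_iff.2 ⟨x⟩), ?_⟩
  rw [← ho, pow_mod_orderOf, hk]

omit [Fintype α] [DecidableEq α] in
/-- Reduction of orbit times modulo a period: `π^p y = y` implies `π^i y = π^(i mod p) y`.
[folklore] -/
theorem pow_apply_eq_pow_mod_apply {f : Perm α} {y : α} {p : ℕ} (hp : (f ^ p) y = y) (i : ℕ) :
    (f ^ i) y = (f ^ (i % p)) y := by
  conv_lhs => rw [← Nat.mod_add_div i p, pow_add, pow_mul, Perm.mul_apply,
    Perm.pow_apply_eq_self_of_apply_eq_self hp]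

end FullCycle

/-! ### The first return map `π*` (JS p. 890) -/

section FirstReturn

variable {π : Perm α} {S : Finset α}

open Classical in
/-- The first point of `S` on the forward orbit `y, π y, π² y, …` of `y` (junk value `y` if the
orbit misses `S`). [cite: JerrumSnir1982, §4.4 (p. 890)] -/
def firstIn (π : Perm α) (S : Finset α) (y : α) : α :=
  if h : ∃ m : ℕ, (π ^ m) y ∈ S then (π ^ Nat.find h) y else y

/-- **JS's `π*`**: the first return to `S`, `π*(x) = π^a(x)` with `a ≥ 1` least such that
`π^a(x) ∈ S`. [cite: JerrumSnir1982, §4.4 (p. 890)] -/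
def ret (π : Perm α) (S : Finset α) (x : α) : α :=
  firstIn π S (π x)

/-- For a full cycle and nonempty `S` every forward orbit meets `S`. [cite: JerrumSnir1982, §4.4 (p. 890)] -/
theorem exists_pow_apply_mem (h : π.cycleType = {Fintype.card α}) (hS : S.Nonempty) (y : α) :
    ∃ m : ℕ, (π ^ m) y ∈ S := by
  obtain ⟨s, hs⟩ := hS
  obtain ⟨m, hm⟩ := exists_pow_apply_eq_of_cycleType h y s
  exact ⟨m, by rw [hm]; exact hs⟩

omit [Fintype α] in
/-- Unfolding of `firstIn` when the orbit meets `S`. [folklore] -/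
theorem firstIn_eq {y : α} (h : ∃ m : ℕ, (π ^ m) y ∈ S) : firstIn π S y = (π ^ Nat.find h) y := by
  unfold firstIn
  rw [dif_pos h]

omit [Fintype α] in
/-- `firstIn` lands in `S`. [folklore] -/
theorem firstIn_mem {y : α} (h : ∃ m : ℕ, (π ^ m) y ∈ S) : firstIn π S y ∈ S := by
  rw [firstIn_eq h]
  exact Nat.find_spec h

omit [Fintype α] in
/-- Two permutations agreeing off `S` have the same orbit segments up to the first visit to `S`.
[cite: JerrumSnir1982, §4.4 (p. 890)] -/
theorem pow_apply_eq_of_agree {π₁ π₂ : Perm α} (hagree : ∀ x ∉ S, π₁ x = π₂ x) {y : α}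
    (h₁ : ∃ m : ℕ, (π₁ ^ m) y ∈ S) : ∀ i ≤ Nat.find h₁, (π₂ ^ i) y = (π₁ ^ i) y := by
  intro i
  induction i with
  | zero => intro; simp
  | succ i ih =>
    intro hi
    have hlt : i < Nat.find h₁ := hi
    have hnot : (π₁ ^ i) y ∉ S := Nat.find_min h₁ hlt
    rw [pow_succ', Perm.mul_apply, pow_succ', Perm.mul_apply, ih hlt.le, hagree _ hnot]

omit [Fintype α] in
/-- **`firstIn` depends only on `π` off `S`.** [cite: JerrumSnir1982, §4.4 (p. 890)] -/
theorem firstIn_eq_of_agree {π₁ π₂ : Perm α} (hagree : ∀ x ∉ S, π₁ x = π₂ x) {y : α}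
    (h₁ : ∃ m : ℕ, (π₁ ^ m) y ∈ S) : firstIn π₂ S y = firstIn π₁ S y := by
  have hpt := pow_apply_eq_of_agree hagree h₁
  have hmem : (π₂ ^ Nat.find h₁) y ∈ S := by
    rw [hpt _ le_rfl]
    exact Nat.find_spec h₁
  have h₂ : ∃ m : ℕ, (π₂ ^ m) y ∈ S := ⟨Nat.find h₁, hmem⟩
  have hfind : Nat.find h₂ = Nat.find h₁ := by
    rw [Nat.find_eq_iff]
    refine ⟨hmem, fun k hk => ?_⟩
    rw [hpt _ hk.le]
    exact Nat.find_min h₁ hk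
  rw [firstIn_eq h₂, firstIn_eq h₁, hfind, hpt _ le_rfl]

/-- **`x ↦ π*(x)` is injective on `S`** (for a full cycle `π`): if the orbits of `π x` and `π x'`
first meet `S` at the same point then `x = x'`, since otherwise the shorter chain would be a proper
tail of the longer one and `x ∈ S` (resp. `x'`) would occur on it before its end.
[cite: JerrumSnir1982, §4.4 (p. 890)] -/
theorem firstIn_apply_injOn (h : π.cycleType = {Fintype.card α}) (hS : S.Nonempty) {x x' : α}
    (hx : x ∈ S) (hx' : x' ∈ S) (heq : firstIn π S (π x) = firstIn π S (π x')) : x = x' := by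
  suffices aux : ∀ {x x' : α}, x ∈ S → x' ∈ S → firstIn π S (π x) = firstIn π S (π x') →
      Nat.find (exists_pow_apply_mem h hS (π x)) ≤ Nat.find (exists_pow_apply_mem h hS (π x')) →
        x = x' by
    rcases le_total (Nat.find (exists_pow_apply_mem h hS (π x)))
      (Nat.find (exists_pow_apply_mem h hS (π x'))) with hle | hle
    · exact aux hx hx' heq hle
    · exact (aux hx' hx heq.symm hle).symm
  intro x x' hx hx' heq hle
  rw [firstIn_eq (exists_pow_apply_mem h hS (π x)),
    firstIn_eq (exists_pow_apply_mem h hS (π x'))] at heq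
  obtain ⟨k, hk⟩ := Nat.exists_eq_add_of_le hle
  rw [hk, pow_add, Perm.mul_apply] at heq
  have heq' : π x = (π ^ k) (π x') := (π ^ _).injective heq
  cases k with
  | zero => exact π.injective (by simpa using heq')
  | succ k =>
    exfalso
    have h1 : x = (π ^ k) (π x') := by
      rw [pow_succ', Perm.mul_apply] at heq'
      exact π.injective heq'
    have h2 : (π ^ k) (π x') ∈ S := by
      rw [← h1]
      exact hx
    have h3 : k < Nat.find (exists_pow_apply_mem h hS (π x')) := by omega
    exact Nat.find_min (exists_pow_apply_mem h hS (π x')) h3 h2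

/-- `π*` maps `S` (indeed everything) into `S`. [cite: JerrumSnir1982, §4.4 (p. 890)] -/
theorem ret_mem (h : π.cycleType = {Fintype.card α}) (hS : S.Nonempty) (x : α) : ret π S x ∈ S :=
  firstIn_mem (exists_pow_apply_mem h hS (π x))

/-- **"`π` is completely determined by `π*` and the restriction of `π` to `I_b ∪ I_c`"**: two full
cycles agreeing off `S` and with the same first-return map on `S` are equal.
[cite: JerrumSnir1982, §4.4 (p. 890)] -/
theorem eq_of_ret_eq {π₁ π₂ : Perm α} (h₁ : π₁.cycleType = {Fintype.card α})
    (hS : S.Nonempty) (hagree : ∀ x ∉ S, π₁ x = π₂ x)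
    (hret : ∀ x ∈ S, ret π₁ S x = ret π₂ S x) : π₁ = π₂ := by
  ext x
  by_cases hx : x ∈ S
  · set z := π₁.symm (π₂ x) with hz
    have hz1 : π₁ z = π₂ x := π₁.apply_symm_apply _
    have hzS : z ∈ S := by
      by_contra hzS
      have h3 : π₁ z = π₂ z := hagree z hzS
      rw [hz1] at h3
      have h4 : x = z := π₂.injective h3
      exact hzS (h4 ▸ hx)
    have hfi : firstIn π₁ S (π₁ x) = firstIn π₁ S (π₁ z) := by
      rw [hz1, ← firstIn_eq_of_agree hagree (exists_pow_apply_mem h₁ hS (π₂ x))]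
      exact hret x hx
    rw [← hz1]
    exact congr_arg π₁ (firstIn_apply_injOn h₁ hS hx hzS hfi)
  · exact hagree x hx

/-- **`π*` as a permutation of `S`** (a full cycle `π`, `S` nonempty): `x ↦ π*(x)` is an injective
self-map of the finite set `S`. [cite: JerrumSnir1982, §4.4 (p. 890)] -/
def retPerm (π : Perm α) (S : Finset α) (h : π.cycleType = {Fintype.card α}) (hS : S.Nonempty) :
    Perm ↥S :=
  Equiv.ofBijective (fun x : ↥S => (⟨ret π S x, ret_mem h hS x⟩ : ↥S))
    (Finite.injective_iff_bijective.1 fun x x' hxx' =>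
      Subtype.ext (firstIn_apply_injOn h hS x.2 x'.2 (congr_arg Subtype.val hxx')))

/-- The underlying map of `retPerm` is `ret`. [folklore] -/
@[simp] theorem retPerm_apply_val (h : π.cycleType = {Fintype.card α}) (hS : S.Nonempty) (x : ↥S) :
    ((retPerm π S h hS x : ↥S) : α) = ret π S x := rfl

/-- Powers of `retPerm` are iterates of `ret`. [folklore] -/
theorem retPerm_pow_apply_val (h : π.cycleType = {Fintype.card α}) (hS : S.Nonempty) (k : ℕ)
    (x : ↥S) : (((retPerm π S h hS ^ k) x : ↥S) : α) = (ret π S)^[k] x := by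
  induction k generalizing x with
  | zero => rfl
  | succ k ih =>
    rw [pow_succ', Perm.mul_apply, Function.iterate_succ_apply', retPerm_apply_val, ih]

/-- Iterates of `π*` stay in `S`. [folklore] -/
theorem iterate_ret_mem (h : π.cycleType = {Fintype.card α}) (hS : S.Nonempty) {x : α} (hx : x ∈ S)
    (k : ℕ) : (ret π S)^[k] x ∈ S := by
  induction k with
  | zero => simpa using hx
  | succ k _ =>
    rw [Function.iterate_succ_apply']
    exact ret_mem h hS _

/-- **`π*` has no fixed point** on `S` as soon as `S` has another element: a first return
`π^{a}(x) = x` would be a return of the full cycle before it has visited the rest of `S`.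
[cite: JerrumSnir1982, §4.4 (p. 890)] -/
theorem ret_ne_self (h : π.cycleType = {Fintype.card α}) (hS : S.Nonempty) {x : α}
    (h2 : ∃ x' ∈ S, x' ≠ x) : ret π S x ≠ x := by
  intro hfix
  obtain ⟨x', hx'S, hx'x⟩ := h2
  have hex := exists_pow_apply_mem h hS (π x)
  have hret : ret π S x = (π ^ Nat.find hex) (π x) := firstIn_eq hex
  rw [hfix] at hret
  have hper : (π ^ (Nat.find hex + 1)) x = x := by
    rw [pow_succ, Perm.mul_apply]
    exact hret.symm
  have hcard : Fintype.card α ≤ Nat.find hex + 1 := card_le_of_pow_apply_eq_self h (Nat.succ_pos _) hper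
  obtain ⟨j, hj, hjx⟩ := exists_pow_lt_apply_eq_of_cycleType h x x'
  cases j with
  | zero => exact hx'x (by simpa using hjx.symm)
  | succ j =>
    have h1 : (π ^ j) (π x) = x' := by
      rw [← Perm.mul_apply, ← pow_succ]
      exact hjx
    have h3 : j < Nat.find hex := by omega
    apply Nat.find_min hex h3
    rw [h1]
    exact hx'S

/-- **`π*` has a single orbit on `S`**: the visits to `S` of the `π`-orbit of `x ∈ S` (which is
everything) are the `π*`-iterates of `x`. [cite: JerrumSnir1982, §4.4 (p. 890)] -/
theorem exists_iterate_ret_eq (h : π.cycleType = {Fintype.card α}) (hS : S.Nonempty) {x v : α}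
    (hx : x ∈ S) (hv : v ∈ S) : ∃ k : ℕ, (ret π S)^[k] x = v := by
  classical
  obtain ⟨j, hj⟩ := exists_pow_apply_eq_of_cycleType h x v
  let P : ℕ → Prop := fun t => ∃ k : ℕ, (ret π S)^[k] x = (π ^ t) x
  have hP0 : P 0 := ⟨0, by simp⟩
  have ht₀ : P (Nat.findGreatest P j) := Nat.findGreatest_spec (Nat.zero_le j) hP0
  have ht₀le : Nat.findGreatest P j ≤ j := Nat.findGreatest_le j
  obtain ⟨k, hk⟩ := ht₀
  rcases ht₀le.eq_or_lt with heq | hlt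
  · exact ⟨k, by rw [hk, heq, hj]⟩
  · exfalso
    set t₀ := Nat.findGreatest P j with ht₀def
    set y := (π ^ t₀) x with hy
    have hyS : y ∈ S := by
      rw [← hk]
      exact iterate_ret_mem h hS hx k
    have hex := exists_pow_apply_mem h hS (π y)
    have hvis : (π ^ (j - t₀ - 1)) (π y) ∈ S := by
      have h1 : (π ^ (j - t₀ - 1)) (π y) = v := by
        rw [← Perm.mul_apply, ← pow_succ, hy, ← Perm.mul_apply, ← pow_add,
          show j - t₀ - 1 + 1 + t₀ = j by omega, hj]
      rw [h1]
      exact hv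
    have hmle : Nat.find hex ≤ j - t₀ - 1 := Nat.find_le hvis
    have hP1 : P (t₀ + Nat.find hex + 1) := by
      refine ⟨k + 1, ?_⟩
      rw [Function.iterate_succ_apply', hk]
      show firstIn π S (π y) = _
      rw [firstIn_eq hex, ← Perm.mul_apply, ← pow_succ]
      show (π ^ (Nat.find hex + 1)) ((π ^ t₀) x) = _
      rw [← Perm.mul_apply, ← pow_add, show Nat.find hex + 1 + t₀ = t₀ + Nat.find hex + 1 by omega]
    have hle : t₀ + Nat.find hex + 1 ≤ j := by omega
    exact Nat.findGreatest_is_greatest (by omega : Nat.findGreatest P j < t₀ + Nat.find hex + 1) hle hP1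

/-- **`π*` is a cyclic permutation of `S`** (`|S| ≥ 2`): "We observe that `π*` is a cyclic
permutation". [cite: JerrumSnir1982, §4.4 (p. 890)] -/
theorem retPerm_cycleType (h : π.cycleType = {Fintype.card α}) (hS : S.Nonempty) (h2 : 1 < S.card) :
    (retPerm π S h hS).cycleType = {S.card} := by
  have hne : ∀ x : ↥S, retPerm π S h hS x ≠ x := by
    intro x hx
    obtain ⟨x', hx', hne⟩ := Finset.exists_mem_ne h2 (x : α)
    exact ret_ne_self h hS ⟨x', hx', hne⟩ (congr_arg Subtype.val hx)
  have hsupp : (retPerm π S h hS).support = Finset.univ :=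
    Finset.eq_univ_iff_forall.2 fun x => Perm.mem_support.2 (hne x)
  obtain ⟨x₀, hx₀⟩ := id hS
  have hcyc : (retPerm π S h hS).IsCycle := by
    refine ⟨⟨x₀, hx₀⟩, hne _, fun y _ => ?_⟩
    obtain ⟨k, hk⟩ := exists_iterate_ret_eq h hS hx₀ y.2
    exact ⟨((k : ℕ) : ℤ), Subtype.ext (by rw [zpow_natCast, retPerm_pow_apply_val]; exact hk)⟩
  rw [hcyc.cycleType, hsupp, Finset.card_univ, Fintype.card_coe]

/-- **The extension count** ("the number of extensions of `π` to `I_a` is bounded by the number of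
cyclic permutations on `d` objects; that is, `|mon(a)| ≤ (d - 1)!`"): a set `C` of full cycles of
`α` that pairwise agree off the nonempty set `S`, `|S| = d`, has at most `(d - 1)!` elements — by the
injection `π ↦ π*` (`eq_of_ret_eq`) into the cyclic permutations of `S`, of which there are
`(d - 1)!` (`Equiv.Perm.card_of_cycleType_singleton`), and directly for `d = 1`.
[cite: JerrumSnir1982, §4.4 (p. 890)] -/
theorem card_le_factorial_of_agree {S : Finset α} (hS : S.Nonempty) (C : Finset (Perm α))
    (hfull : ∀ π ∈ C, π.cycleType = {Fintype.card α})
    (hagree : ∀ π₁ ∈ C, ∀ π₂ ∈ C, ∀ x ∉ S, π₁ x = π₂ x) : C.card ≤ (S.card - 1).factorial := by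
  rcases Nat.lt_or_ge 1 S.card with h2 | h1
  · -- injection into the cyclic permutations of `↥S`
    let f : Perm α → Perm ↥S := fun π =>
      if hπ : π.cycleType = {Fintype.card α} then retPerm π S hπ hS else 1
    have hmaps : Set.MapsTo f C ({g | g.cycleType = {S.card}} : Finset (Perm ↥S)) := by
      intro π hπ
      have hπ' : π ∈ C := hπ
      have hfπ : f π = retPerm π S (hfull π hπ') hS := dif_pos (hfull π hπ')
      rw [Finset.mem_coe, Finset.mem_filter, hfπ]
      exact ⟨Finset.mem_univ _, retPerm_cycleType (hfull π hπ') hS h2⟩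
    have hinj : Set.InjOn f C := by
      intro π₁ h₁ π₂ h₂ heq
      have h₁' := hfull π₁ h₁
      have h₂' := hfull π₂ h₂
      have e₁ : f π₁ = retPerm π₁ S h₁' hS := dif_pos h₁'
      have e₂ : f π₂ = retPerm π₂ S h₂' hS := dif_pos h₂'
      rw [e₁, e₂] at heq
      refine eq_of_ret_eq h₁' hS (hagree π₁ h₁ π₂ h₂) fun x hx => ?_
      have h3 := congr_arg (fun g : Perm ↥S => ((g ⟨x, hx⟩ : ↥S) : α)) heq
      simpa using h3
    calc C.card ≤ ({g | g.cycleType = {S.card}} : Finset (Perm ↥S)).card :=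
          Finset.card_le_card_of_injOn f hmaps hinj
      _ = (S.card - 1).factorial := by
          have h3 := Equiv.Perm.card_of_cycleType_singleton (α := ↥S) (n := S.card) h2
            (by rw [Fintype.card_coe])
          rw [Fintype.card_coe, Nat.choose_self, mul_one] at h3
          exact h3
  · -- `|S| = 1`: `π*` is forced, so `C` has at most one element
    have hcard : S.card = 1 := le_antisymm h1 hS.card_pos
    obtain ⟨x₀, rfl⟩ := Finset.card_eq_one.1 hcard
    rw [Finset.card_singleton]
    refine Finset.card_le_one.2 fun π₁ h₁ π₂ h₂ => ?_
    refine eq_of_ret_eq (hfull π₁ h₁) hS (hagree π₁ h₁ π₂ h₂) fun x _ => ?_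
    have m1 := ret_mem (hfull π₁ h₁) hS x
    have m2 := ret_mem (hfull π₂ h₂) hS x
    rw [Finset.mem_singleton] at m1 m2
    rw [m1, m2]

end FirstReturn

/-! ### Inserting a vertex into a cycle -/

section Insert

/-- **Inserting a vertex into a cycle.** If `π'` is a cycle, `j` a fixed point of `π'` and `y` a
moved point, then `π = swap j y * π'` — which sends `π'⁻¹ y ↦ j ↦ y` and agrees with `π'`
elsewhere — is a cycle with support `insert j (support π')`. (Converse direction of Mathlib's
`Equiv.Perm.IsCycle.swap_mul`; used to splice the end vertex back into a Hamiltonian path in the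
dynamic programme of JS p. 890–891.) [cite: JerrumSnir1982, §4.4 (pp. 890–891)] -/
theorem isCycle_swap_mul_of_apply_eq_self {π' : Perm α} (hc : π'.IsCycle) {j y : α} (hj : π' j = j)
    (hy : π' y ≠ y) :
    (swap j y * π').IsCycle ∧ (swap j y * π').support = insert j π'.support := by
  set π := swap j y * π' with hπ
  have hyj : y ≠ j := fun h => hy (by rw [h, hj])
  have hπj : π j = y := by rw [hπ, Perm.mul_apply, hj, swap_apply_left]
  have hπeq : ∀ z, π' z ≠ y → π' z ≠ j → π z = π' z := fun z h1 h2 => by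
    rw [hπ, Perm.mul_apply, swap_apply_of_ne_of_ne h2 h1]
  have hπ'y : π' y ≠ j := fun h => hyj (π'.injective (h.trans hj.symm))
  -- the orbit of `j` under `π` follows the orbit of `y` under `π'` until it reaches `π'⁻¹ y`
  have claim : ∀ i : ℕ, (∀ i' < i, (π' ^ i') y ≠ π'.symm y) → (π ^ (i + 1)) j = (π' ^ i) y := by
    intro i
    induction i with
    | zero => intro; simpa using hπj
    | succ i ih =>
      intro hi
      have h1 := ih fun i' hi' => hi i' (Nat.lt_succ_of_lt hi')
      rw [pow_succ', Perm.mul_apply, h1, pow_succ', Perm.mul_apply]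
      apply hπeq
      · intro h2
        exact hi i (Nat.lt_succ_self i) (by rw [Equiv.eq_symm_apply]; exact h2)
      · intro h2
        have hz : (π' ^ i) y = j := π'.injective (h2.trans hj.symm)
        have h3 : (π' ^ i) y ∈ π'.support := Perm.pow_apply_mem_support.2 (Perm.mem_support.2 hy)
        rw [hz, Perm.mem_support] at h3
        exact h3 hj
  have hcyc : π.IsCycle := by
    refine ⟨j, by rw [hπj]; exact hyj, fun w hw => ?_⟩
    by_cases hwj : w = j
    · subst hwj
      exact ⟨0, by simp⟩
    have hw' : π' w ≠ w := by
      intro hfix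
      apply hw
      have hwy : w ≠ y := fun h' => hy (by rw [← h']; exact hfix)
      rw [hπ, Perm.mul_apply, hfix, swap_apply_of_ne_of_ne hwj hwy]
    classical
    obtain ⟨i₀, hi₀⟩ := hc.exists_pow_eq hy hw'
    have hex : ∃ i : ℕ, (π' ^ i) y = w := ⟨i₀, hi₀⟩
    have hi : (π' ^ Nat.find hex) y = w := Nat.find_spec hex
    have hmin : ∀ i' < Nat.find hex, (π' ^ i') y ≠ π'.symm y := by
      intro i' hi' heq
      have hper : (π' ^ (i' + 1)) y = y := by
        rw [pow_succ', Perm.mul_apply, heq, Equiv.apply_symm_apply]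
      have hmod := pow_apply_eq_pow_mod_apply hper (Nat.find hex)
      have hlt : Nat.find hex % (i' + 1) < Nat.find hex :=
        lt_of_lt_of_le (Nat.mod_lt _ (Nat.succ_pos _)) hi'
      apply Nat.find_min hex hlt
      rw [← hmod]
      exact hi
    exact ⟨((Nat.find hex + 1 : ℕ) : ℤ), by rw [zpow_natCast, claim _ hmin, hi]⟩
  have hsupp : π.support = insert j π'.support := by
    have h1 : π (π j) ≠ j := by
      rw [hπj, hπeq y hy hπ'y]
      exact hπ'y
    have h2 := support_swap_mul_eq π j h1
    rw [hπj] at h2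
    have h3 : swap j y * π = π' := by rw [hπ, swap_mul_self_mul]
    rw [h3] at h2
    have hjmem : j ∈ π.support := Perm.mem_support.2 (by rw [hπj]; exact hyj)
    rw [h2, Finset.sdiff_singleton_eq_erase, Finset.insert_erase hjmem]
  exact ⟨hcyc, hsupp⟩

end Insert

end JerrumSnir

end Literature.Barriers.ValiantsHypothesis
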